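import Summits.ResolutionOfSingularities.ResolutionOfSingularities.Theorems.PurelyInseparableDim4IsolationAutomorphism
import Summits.ResolutionOfSingularities.ResolutionOfSingularities.Theorems.PurelyInseparableDim4IsolatedCleaning
import Summits.ResolutionOfSingularities.ResolutionOfSingularities.Theorems.PurelyInseparableDim4Straightening
import Summits.ResolutionOfSingularities.ResolutionOfSingularities.Theorems.PurelyInseparableDim4NarrowApolarity
import HarnessLib
import HarnessLib.Audit.Tags

/-!
# Purely inseparable four-folds — isolation, `J_q⁺` and `ord₀` under coordinate changes that are invertible only
# MODULO `𝔪₀ᴹ`, under `𝔪₀ᴹ`-perturbations and under `p`-th-power units (cell `res-dim4-pi`, K2(p) lane, brick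
# «swap normalisation», FILE SN2)

[OURS · counted 0 · cell `res-dim4-pi` · seat res-dim4-p-7 g3 · desk WORD #116 («swap normalisation», booked); the statement is
res-dim4-idea-4 g3's AUT-INV (01:27Z) in the form the swap needs.]  Nothing here proves K2(p), `NoIsolatedTrap p p`, or
resolution of singularities in dimension ≥ 4 / characteristic `p`.  AI kernel work, weaker than expert review.

Two chart presentations of one closed point of a point blow-up differ by `x_i ↦ x_i · (unit)` — an automorphism of every
jet algebra `K[x]/𝔪₀ᴹ` but NOT of `K[x]` — and the residual polynomials by a `p`-th-power unit factor and by terms of high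
order.  p-11 g2's `…IsolationAutomorphism` did exact automorphisms and the Hasse–Schmidt functoriality
`CoordChange.singLocusIdeal_aeval_le` for every endomorphism; this file adds:
* §1 ideal toolkit: `aeval_sub_aeval_mem` (substitutions congruent mod `I` give values congruent mod `I`), Hasse derivatives
  of `𝔪₀ᴹ` lie in `𝔪₀^{M−|α|}`, `J_q⁺(F + E) ≤ J_q⁺(F) + 𝔪₀^{M−q}` for `E ∈ 𝔪₀ᴹ`;
* §2 **approximate automorphisms** (`g, g'` origin-fixing with `g(g'(x)) ≡ x ≡ g'(g(x)) mod 𝔪₀ᴹ`):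
  `(J_q⁺ F)·K[x] ≤ J_q⁺(aeval g F) + 𝔪₀^{M−q}` (`map_singLocusIdeal_le_sup`), the certificate transport
  `isCert_aeval` and **`isIsolated_aeval`**; `ordZero_aeval` (`ord₀` is kept once `M > ord₀ F`);
* §3 perturbations: `isIsolated_add_of_mem_pow` (`E ∈ 𝔪₀ᴹ`, `M` past the certificate);
* §4 `p`-th-power units (Lucas: `D^{(α)}(u^p F) = u^p D^{(α)} F` for `|α| < p`): `singLocusIdeal_pow_char_mul`,
  **`isIsolated_pow_char_mul_iff`**, `ordZero_pow_char_mul`.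
bears_on: LADDER-RESOLUTION:D157-DOOR2 (res-dim4-pi · K2(p) · swap normalisation SN2).  Supports
stmt-ResolutionOfSingularities-16155 (helper).
-/

set_option linter.dupNamespace false -- mandated namespace of this single-conjunct summit

noncomputable section

namespace Summit.ResolutionOfSingularities.ResolutionOfSingularities.Theorems.PIDim4

namespace ApproxCoordChange

open MvPolynomial Finset
open Literature.AlgebraicGeometry.Resolution
open Literature.AlgebraicGeometry.Resolution.Hauser2010

variable {K : Type} [Field K]

/-! ## §1 Ideal toolkit -/

/-- Substitutions congruent modulo an ideal give values congruent modulo that ideal. [folklore] -/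
theorem aeval_sub_aeval_mem {I : Ideal (MvPolynomial (Fin 4) K)} {θ₁ θ₂ : Fin 4 → MvPolynomial (Fin 4) K}
    (h : ∀ i, θ₁ i - θ₂ i ∈ I) (F : MvPolynomial (Fin 4) K) : aeval θ₁ F - aeval θ₂ F ∈ I := by
  rw [← Ideal.Quotient.eq]
  change (Ideal.Quotient.mkₐ K I).comp (aeval θ₁) F = (Ideal.Quotient.mkₐ K I).comp (aeval θ₂) F
  rw [MvPolynomial.comp_aeval, MvPolynomial.comp_aeval]
  congr 2
  funext i
  exact Ideal.Quotient.eq.mpr (h i)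

/-- `aeval g (aeval g' F) = aeval (g ∘∘ g') F`. [folklore] -/
theorem aeval_aeval (g g' : Fin 4 → MvPolynomial (Fin 4) K) (F : MvPolynomial (Fin 4) K) :
    aeval g (aeval g' F) = aeval (fun i => aeval g (g' i)) F := by
  change ((aeval g).comp (aeval g')) F = _
  rw [MvPolynomial.comp_aeval]

/-- Membership in `𝔪₀ᴹ` read on coefficients. [folklore] -/
theorem mem_pow_iff (M : ℕ) (G : MvPolynomial (Fin 4) K) :
    G ∈ originIdeal K ^ M ↔ ∀ d : Fin 4 →₀ ℕ, d.degree < M → coeff d G = 0 :=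
  IsolationCert.mem_originIdeal_pow_iff M G

/-- `𝔪₀` is spanned by the variables. [folklore] -/
theorem originIdeal_eq_span_range_X : originIdeal K = Ideal.span (Set.range (X : Fin 4 → MvPolynomial (Fin 4) K)) := by
  rw [IsolationCert.originIdeal_eq_idealOfVars]

/-- A Hasse derivative of order `|α|` maps `𝔪₀ᴹ` into `𝔪₀^{M − |α|}`. [folklore] -/
theorem hasseDeriv_mem_pow {M : ℕ} {E : MvPolynomial (Fin 4) K} (hE : E ∈ originIdeal K ^ M)
    (α : Fin 4 →₀ ℕ) : hasseDeriv α E ∈ originIdeal K ^ (M - α.degree) := by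
  rw [mem_pow_iff] at hE ⊢
  intro d hd
  rw [IsolatedBand.coeff_hasseDeriv, hE (d + α) (by rw [map_add]; omega), mul_zero]

/-- `J_q⁺(F + E) ≤ J_q⁺(F) + 𝔪₀^{M−q}` for `E ∈ 𝔪₀ᴹ`. [folklore] -/
theorem singLocusIdeal_add_le {q M : ℕ} (F : MvPolynomial (Fin 4) K) {E : MvPolynomial (Fin 4) K}
    (hE : E ∈ originIdeal K ^ M) :
    singLocusIdeal q (F + E) ≤ singLocusIdeal q F ⊔ originIdeal K ^ (M - q) := by
  unfold singLocusIdeal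
  rw [Ideal.span_le]
  rintro _ ⟨α, h0, hq, rfl⟩
  rw [IsolatedBand.hasseDeriv_add]
  refine Ideal.add_mem _ (Ideal.mem_sup_left (Ideal.subset_span ⟨α, h0, hq, rfl⟩))
    (Ideal.mem_sup_right (Ideal.pow_le_pow_right (by omega) (hasseDeriv_mem_pow hE α)))

/-- The symmetric form: `J_q⁺(F) ≤ J_q⁺(F + E) + 𝔪₀^{M−q}`. [folklore] -/
theorem singLocusIdeal_le_add {q M : ℕ} (F : MvPolynomial (Fin 4) K) {E : MvPolynomial (Fin 4) K}
    (hE : E ∈ originIdeal K ^ M) :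
    singLocusIdeal q F ≤ singLocusIdeal q (F + E) ⊔ originIdeal K ^ (M - q) := by
  have h := singLocusIdeal_add_le (q := q) (F + E) ((originIdeal K ^ M).neg_mem hE)
  rwa [add_neg_cancel_right] at h

/-- An origin-fixing substitution maps `𝔪₀ⁿ` into `𝔪₀ⁿ`. [folklore] -/
theorem map_pow_le {g : Fin 4 → MvPolynomial (Fin 4) K} (hg : ∀ i, constantCoeff (g i) = 0) (n : ℕ) :
    (originIdeal K ^ n).map (aeval g).toRingHom ≤ originIdeal K ^ n := by
  rw [Ideal.map_le_iff_le_comap]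
  intro P hP
  rw [Ideal.mem_comap, IsolationCert.originIdeal_eq_idealOfVars]
  rw [IsolationCert.originIdeal_eq_idealOfVars] at hP
  exact Literature.RingTheory.MvPolynomial.aeval_mem_idealOfVars_pow g hg hP

/-- For `g(g'(x)) ≡ x mod 𝔪₀ᴹ`: extending an ideal along `g'` and then along `g` lands in the ideal plus `𝔪₀ᴹ`.
[folklore] -/
theorem map_map_le_sup {g g' : Fin 4 → MvPolynomial (Fin 4) K} {M : ℕ}
    (hgg' : ∀ i, aeval g (g' i) - X i ∈ originIdeal K ^ M) (I : Ideal (MvPolynomial (Fin 4) K)) :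
    (I.map (aeval g').toRingHom).map (aeval g).toRingHom ≤ I ⊔ originIdeal K ^ M := by
  rw [Ideal.map_map, Ideal.map_le_iff_le_comap]
  intro h hh
  rw [Ideal.mem_comap]
  have hc : ((aeval g).toRingHom.comp (aeval g').toRingHom) h = aeval (fun i => aeval g (g' i)) h := by
    change aeval g (aeval g' h) = _
    exact aeval_aeval g g' h
  rw [hc]
  have hsub : aeval (fun i => aeval g (g' i)) h - aeval X h ∈ originIdeal K ^ M := aeval_sub_aeval_mem hgg' h
  rw [MvPolynomial.aeval_X_left, AlgHom.id_apply] at hsub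
  have : aeval (fun i => aeval g (g' i)) h = h + (aeval (fun i => aeval g (g' i)) h - h) := by ring
  rw [this]
  exact Ideal.add_mem _ (Ideal.mem_sup_left hh) (Ideal.mem_sup_right hsub)

/-- `𝔪₀ ≤ 𝔪₀·K[x] (extended along `g`) + 𝔪₀ᴹ` when `g(g'(x)) ≡ x` and `g'` fixes the origin. [folklore] -/
theorem originIdeal_le_map_sup {g g' : Fin 4 → MvPolynomial (Fin 4) K} {M : ℕ}
    (hg' : ∀ i, constantCoeff (g' i) = 0) (hgg' : ∀ i, aeval g (g' i) - X i ∈ originIdeal K ^ M) :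
    originIdeal K ≤ (originIdeal K).map (aeval g).toRingHom ⊔ originIdeal K ^ M := by
  conv_lhs => rw [originIdeal_eq_span_range_X]
  rw [Ideal.span_le]
  rintro _ ⟨i, rfl⟩
  have : (X i : MvPolynomial (Fin 4) K) = aeval g (g' i) - (aeval g (g' i) - X i) := by ring
  rw [SetLike.mem_coe, this]
  refine Ideal.sub_mem _ (Ideal.mem_sup_left (Ideal.mem_map_of_mem _ ?_)) (Ideal.mem_sup_right (hgg' i))
  exact (NarrowApolarity.mem_originIdeal_iff _).mpr (hg' i)

/-- … and the same for every power: `𝔪₀ⁿ ≤ 𝔪₀ⁿ·K[x] (extended along `g`) + 𝔪₀ᴹ`. [folklore] -/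
theorem pow_le_map_pow_sup {g g' : Fin 4 → MvPolynomial (Fin 4) K} {M : ℕ}
    (hg' : ∀ i, constantCoeff (g' i) = 0) (hgg' : ∀ i, aeval g (g' i) - X i ∈ originIdeal K ^ M) (n : ℕ) :
    originIdeal K ^ n ≤ (originIdeal K ^ n).map (aeval g).toRingHom ⊔ originIdeal K ^ M := by
  induction n with
  | zero => rw [pow_zero, Ideal.one_eq_top, Ideal.map_top]; exact le_sup_left
  | succ n ih =>
    have hAB : (originIdeal K ^ n).map (aeval g).toRingHom * (originIdeal K).map (aeval g).toRingHom =
        (originIdeal K ^ (n + 1)).map (aeval g).toRingHom := by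
      rw [← Ideal.map_mul, ← pow_succ]
    rw [pow_succ]
    refine (Ideal.mul_mono ih (originIdeal_le_map_sup hg' hgg')).trans ?_
    rw [Ideal.sup_mul, Ideal.mul_sup, Ideal.mul_sup, hAB]
    refine sup_le (sup_le le_sup_left ?_) (sup_le ?_ ?_)
    · exact le_sup_of_le_right Ideal.mul_le_left
    · exact le_sup_of_le_right Ideal.mul_le_right
    · exact le_sup_of_le_right Ideal.mul_le_left

/-! ## §2 `J_q⁺`, certificates, isolation and `ord₀` under approximate automorphisms -/

section Approx

variable {q M : ℕ} {g g' : Fin 4 → MvPolynomial (Fin 4) K}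

/-- **`(J_q⁺ F)·K[x] ≤ J_q⁺(aeval g F) + 𝔪₀^{M−q}`** for an approximate automorphism `g` (inverse `g'` modulo
`𝔪₀ᴹ`, both origin-fixing): the reverse of p-11's `singLocusIdeal_aeval_le`, up to `𝔪₀^{M−q}`. [folklore] -/
theorem map_singLocusIdeal_le_sup (hg : ∀ i, constantCoeff (g i) = 0)
    (hgg' : ∀ i, aeval g (g' i) - X i ∈ originIdeal K ^ M) (hg'g : ∀ i, aeval g' (g i) - X i ∈ originIdeal K ^ M)
    (F : MvPolynomial (Fin 4) K) :
    (singLocusIdeal q F).map (aeval g).toRingHom ≤ singLocusIdeal q (aeval g F) ⊔ originIdeal K ^ (M - q) := by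
  -- `F ≡ g'(g(F))` modulo `𝔪₀ᴹ`
  have hE : F - aeval g' (aeval g F) ∈ originIdeal K ^ M := by
    have h := (originIdeal K ^ M).neg_mem (aeval_sub_aeval_mem hg'g F)
    rwa [neg_sub, MvPolynomial.aeval_X_left, AlgHom.id_apply, ← aeval_aeval g' g F] at h
  -- `J F ≤ J(g' g F) + 𝔪^{M+1-q} ≤ (J (g F))·g' + 𝔪^{M+1-q}`
  have h1 : singLocusIdeal q F ≤
      (singLocusIdeal q (aeval g F)).map (aeval g').toRingHom ⊔ originIdeal K ^ (M - q) := by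
    have hF : aeval g' (aeval g F) + (F - aeval g' (aeval g F)) = F := add_sub_cancel _ _
    have h : singLocusIdeal q (aeval g' (aeval g F) + (F - aeval g' (aeval g F))) ≤
        singLocusIdeal q (aeval g' (aeval g F)) ⊔ originIdeal K ^ (M - q) :=
      singLocusIdeal_add_le (q := q) (aeval g' (aeval g F)) hE
    rw [hF] at h
    have h2 : singLocusIdeal q (aeval g' (aeval g F)) ≤ (singLocusIdeal q (aeval g F)).map (aeval g').toRingHom :=
      CoordChange.singLocusIdeal_aeval_le q g' (aeval g F)
    exact h.trans (sup_le_sup_right h2 _)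
  -- extend along `g`
  refine (Ideal.map_mono h1).trans ?_
  rw [Ideal.map_sup]
  have hMM : M - q ≤ M := by omega
  refine sup_le ((map_map_le_sup hgg' _).trans
    (sup_le_sup_left (Ideal.pow_le_pow_right (I := originIdeal K) hMM) _)) ?_
  exact (map_pow_le hg _).trans le_sup_right

/-- `J_q⁺(aeval g F) ≤ 𝔪₀` if `J_q⁺(F) ≤ 𝔪₀` and `g` fixes the origin. [folklore] -/
theorem singLocusIdeal_aeval_le_originIdeal (hg : ∀ i, constantCoeff (g i) = 0) {F : MvPolynomial (Fin 4) K}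
    (hF : singLocusIdeal q F ≤ originIdeal K) : singLocusIdeal q (aeval g F) ≤ originIdeal K := by
  refine (CoordChange.singLocusIdeal_aeval_le q g F).trans ((Ideal.map_mono hF).trans ?_)
  have h := map_pow_le hg 1
  rwa [pow_one] at h

/-- **The certificate is transported by an approximate automorphism**: `𝔪₀ᴺ ≤ J_q⁺(F) + 𝔪₀ᴺ⁺¹` and
`N + q + 1 ≤ M` give `𝔪₀ᴺ ≤ J_q⁺(aeval g F) + 𝔪₀ᴺ⁺¹`. [folklore] -/
theorem isCert_aeval (hg : ∀ i, constantCoeff (g i) = 0) (hg' : ∀ i, constantCoeff (g' i) = 0)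
    (hgg' : ∀ i, aeval g (g' i) - X i ∈ originIdeal K ^ M) (hg'g : ∀ i, aeval g' (g i) - X i ∈ originIdeal K ^ M)
    {F : MvPolynomial (Fin 4) K} {N : ℕ} (hN : originIdeal K ^ N ≤ singLocusIdeal q F ⊔ originIdeal K ^ (N + 1))
    (hM : N + q + 1 ≤ M) :
    originIdeal K ^ N ≤ singLocusIdeal q (aeval g F) ⊔ originIdeal K ^ (N + 1) := by
  refine (pow_le_map_pow_sup hg' hgg' N).trans
    (sup_le ?_ ((Ideal.pow_le_pow_right (by omega)).trans le_sup_right))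
  refine (Ideal.map_mono hN).trans ?_
  rw [Ideal.map_sup]
  refine sup_le ((map_singLocusIdeal_le_sup hg hgg' hg'g F).trans (sup_le_sup_left (Ideal.pow_le_pow_right ?_) _))
    ((map_pow_le hg _).trans le_sup_right)
  omega

/-- **ISOLATION IS INVARIANT UNDER APPROXIMATE AUTOMORPHISMS**: if the origin is an isolated `q`-fold point of
`z^q + F`, there is a level `M₀` such that for every `M ≥ M₀` and every origin-fixing `g` with an inverse `g'`
modulo `𝔪₀ᴹ`, the origin is an isolated `q`-fold point of `z^q + F(g)`. [folklore] -/
theorem isIsolated_aeval {q : ℕ} {F : MvPolynomial (Fin 4) K} (hF : IsIsolated q F) :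
    ∃ M₀ : ℕ, ∀ M, M₀ ≤ M → ∀ g g' : Fin 4 → MvPolynomial (Fin 4) K,
      (∀ i, constantCoeff (g i) = 0) → (∀ i, constantCoeff (g' i) = 0) →
      (∀ i, aeval g (g' i) - X i ∈ originIdeal K ^ M) → (∀ i, aeval g' (g i) - X i ∈ originIdeal K ^ M) →
      IsIsolated q (aeval g F) := by
  obtain ⟨N, hN⟩ := IsolationConverse.exists_certificate_of_isIsolated hF
  refine ⟨N + q + 1, fun M hM g g' hg hg' hgg' hg'g => ?_⟩
  exact IsolationCert.isIsolated_of_pow_le_sup_pow_succ (singLocusIdeal_aeval_le_originIdeal hg hF.1)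
    (isCert_aeval hg hg' hgg' hg'g hN hM)

/-- **`ord₀` is kept by an approximate automorphism** once `M > ord₀ F`. [folklore] -/
theorem ordZero_aeval (hg : ∀ i, constantCoeff (g i) = 0) (hg' : ∀ i, constantCoeff (g' i) = 0)
    (hg'g : ∀ i, aeval g' (g i) - X i ∈ originIdeal K ^ M) {F : MvPolynomial (Fin 4) K} {n : ℕ}
    (hn : ordZero F = n) (hM : n < M) : ordZero (aeval g F) = n := by
  refine le_antisymm ?_ (hn ▸ CoordChange.ordZero_le_ordZero_aeval g hg F)
  by_contra hlt
  rw [not_le] at hlt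
  -- then `g'(g F)` and `F − g'(g F)` both have order `> n`, so does `F`
  have h1 : ((n + 1 : ℕ) : ℕ∞) ≤ ordZero (aeval g' (aeval g F)) :=
    le_trans (Order.add_one_le_of_lt hlt) (CoordChange.ordZero_le_ordZero_aeval g' hg' _)
  have hE : F - aeval g' (aeval g F) ∈ originIdeal K ^ M := by
    have h := (originIdeal K ^ M).neg_mem (aeval_sub_aeval_mem hg'g F)
    rwa [neg_sub, MvPolynomial.aeval_X_left, AlgHom.id_apply, ← aeval_aeval g' g F] at h
  have h2 : ((n + 1 : ℕ) : ℕ∞) ≤ ordZero (F - aeval g' (aeval g F)) := by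
    rw [natCast_le_ordZero_iff_mem_idealOfVars_pow, ← IsolationCert.originIdeal_eq_idealOfVars]
    exact Ideal.pow_le_pow_right (by omega) hE
  have h3 := le_ordZero_add h1 h2
  rw [add_sub_cancel, hn] at h3
  exact absurd h3 (not_le.mpr (by exact_mod_cast Nat.lt_succ_self n))

end Approx

/-! ## §3 Perturbations of order `≥ M` -/

/-- **Isolation survives perturbations of high order**: `E ∈ 𝔪₀ᴹ` with `M` past the certificate. [folklore] -/
theorem isIsolated_add_of_mem_pow {q : ℕ} {F : MvPolynomial (Fin 4) K} (hF : IsIsolated q F) :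
    ∃ M₀ : ℕ, ∀ M, M₀ ≤ M → ∀ E ∈ originIdeal K ^ M, IsIsolated q (F + E) := by
  obtain ⟨N, hN⟩ := IsolationConverse.exists_certificate_of_isIsolated hF
  refine ⟨N + q + 1, fun M hM E hE => IsolationCert.isIsolated_of_pow_le_sup_pow_succ ?_ (N := N) ?_⟩
  · exact (singLocusIdeal_add_le F hE).trans (sup_le hF.1 (Ideal.pow_le_self (by omega)))
  · exact hN.trans (sup_le ((singLocusIdeal_le_add F hE).trans (sup_le_sup_left (Ideal.pow_le_pow_right (by omega)) _))
      le_sup_right)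

/-- `ord₀ (F + E) = ord₀ F` for `E ∈ 𝔪₀ᴹ`, `M > ord₀ F`. [folklore] -/
theorem ordZero_add_of_mem_pow {F E : MvPolynomial (Fin 4) K} {n M : ℕ} (hn : ordZero F = n)
    (hE : E ∈ originIdeal K ^ M) (hM : n < M) : ordZero (F + E) = n := by
  have h : ordZero F < ordZero E := by
    rw [hn]
    refine lt_of_lt_of_le (by exact_mod_cast hM : ((n : ℕ) : ℕ∞) < (M : ℕ∞)) ?_
    rw [natCast_le_ordZero_iff_mem_idealOfVars_pow, ← IsolationCert.originIdeal_eq_idealOfVars]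
    exact hE
  rw [ordZero_add_eq_left_of_lt h, hn]

/-! ## §4 `p`-th-power units -/

section Units

variable (p : ℕ) [hp : Fact p.Prime] [CharP K p]

/-- Every monomial of `u^p` is a `p`-th power. [folklore] -/
theorem isPthPowerExponent_of_mem_support_pow_char (u : MvPolynomial (Fin 4) K) {d : Fin 4 →₀ ℕ}
    (hd : d ∈ (u ^ p).support) : IsPthPowerExponent p d := by
  classical
  by_contra h
  have h0 := congrArg (coeff d) (Straightening.deletePthPowers_pow_char p u)
  rw [coeff_deletePthPowers, if_neg h, coeff_zero] at h0
  exact (MvPolynomial.mem_support_iff.mp hd) h0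

/-- **Lucas**: `D^{(α)}(u^p · F) = u^p · D^{(α)} F` for `|α| < p` — a `p`-th power is a constant for the
Hasse–Schmidt derivations of order `< p`. [cite: Giraud1975, §1] [folklore] -/
theorem hasseDeriv_pow_char_mul (u F : MvPolynomial (Fin 4) K) {α : Fin 4 →₀ ℕ} (hα : α.degree < p) :
    hasseDeriv α (u ^ p * F) = u ^ p * hasseDeriv α F := by
  classical
  rw [Equimultiple.hasseDeriv_eq, Literature.AlgebraicGeometry.Resolution.hasseDeriv_mul,
    Finset.sum_eq_single (0, α)]
  · rw [Literature.AlgebraicGeometry.Resolution.hasseDeriv_zero_apply, Equimultiple.hasseDeriv_eq]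
  · rintro ⟨β, γ⟩ hmem hne
    simp only [Finset.HasAntidiagonal.mem_antidiagonal] at hmem
    have hβ0 : β ≠ 0 := by
      rintro rfl
      rw [zero_add] at hmem
      exact hne (by rw [hmem])
    have hβ : 0 < β.degree := Nat.pos_of_ne_zero fun h => hβ0 ((Finsupp.degree_eq_zero_iff β).mp h)
    have hβp : β.degree < p := by
      have := congrArg Finsupp.degree hmem
      rw [map_add] at this
      omega
    change Literature.AlgebraicGeometry.Resolution.hasseDeriv K β (u ^ p) * _ = 0
    rw [← Equimultiple.hasseDeriv_eq, IsolatedBand.hasseDeriv_eq_zero_of_forall_isPthPowerExponent p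
      (fun d hd => isPthPowerExponent_of_mem_support_pow_char p u hd) hβ hβp, zero_mul]
  · intro h
    exact absurd (Finset.HasAntidiagonal.mem_antidiagonal.mpr (zero_add α)) h

/-- `J_p⁺(u^p · F) = (u^p) · J_p⁺(F)`. [folklore] -/
theorem singLocusIdeal_pow_char_mul (u F : MvPolynomial (Fin 4) K) :
    singLocusIdeal p (u ^ p * F) = Ideal.span {u ^ p} * singLocusIdeal p F := by
  unfold singLocusIdeal
  rw [Ideal.span_mul_span']
  congr 1
  ext G
  simp only [Set.mem_setOf_eq, Set.singleton_mul, Set.mem_image]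
  constructor
  · rintro ⟨α, h0, hq, rfl⟩
    exact ⟨hasseDeriv α F, ⟨α, h0, hq, rfl⟩, (hasseDeriv_pow_char_mul p u F hq).symm⟩
  · rintro ⟨_, ⟨α, h0, hq, rfl⟩, rfl⟩
    exact ⟨α, h0, hq, (hasseDeriv_pow_char_mul p u F hq).symm⟩

omit hp [CharP K p] in
/-- A unit factor does not change an ideal modulo any power of `𝔪₀`: `I ≤ (v)·I + 𝔪₀ᵏ` for `v(0) ≠ 0`. [folklore] -/
theorem le_span_mul_sup_pow {v : MvPolynomial (Fin 4) K} (hv : constantCoeff v ≠ 0)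
    (I : Ideal (MvPolynomial (Fin 4) K)) (k : ℕ) : I ≤ Ideal.span {v} * I ⊔ originIdeal K ^ k := by
  -- `I ≤ (v) I + 𝔪 I`, iterated
  have hw : v - C (constantCoeff v) ∈ originIdeal K := by
    rw [NarrowApolarity.mem_originIdeal_iff, map_sub, constantCoeff_C, sub_self]
  have step : ∀ J : Ideal (MvPolynomial (Fin 4) K), J ≤ I → J ≤ Ideal.span {v} * I ⊔ originIdeal K * J := by
    intro J hJ h hh
    have : h = C (constantCoeff v)⁻¹ * (v * h) - C (constantCoeff v)⁻¹ * ((v - C (constantCoeff v)) * h) := by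
      have hc : C (constantCoeff v)⁻¹ * C (constantCoeff v) = (1 : MvPolynomial (Fin 4) K) := by
        rw [← C_mul, inv_mul_cancel₀ hv, C_1]
      linear_combination (-(h : MvPolynomial (Fin 4) K)) * hc
    rw [this]
    refine Ideal.sub_mem _ (Ideal.mul_mem_left _ _ (Ideal.mem_sup_left ?_))
      (Ideal.mul_mem_left _ _ (Ideal.mem_sup_right (Ideal.mul_mem_mul hw hh)))
    exact Ideal.mul_mem_mul (Ideal.mem_span_singleton_self v) (hJ hh)
  have key : ∀ n : ℕ, I ≤ Ideal.span {v} * I ⊔ originIdeal K ^ n * I := by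
    intro n
    induction n with
    | zero => rw [pow_zero, one_mul]; exact le_sup_right
    | succ n ihn =>
      refine ihn.trans (sup_le le_sup_left ?_)
      refine (Ideal.mul_mono_right (step I le_rfl)).trans ?_
      rw [Ideal.mul_sup]
      refine sup_le (le_sup_of_le_left Ideal.mul_le_left) (le_sup_of_le_right (le_of_eq ?_))
      rw [← mul_assoc, ← pow_succ]
  exact (key k).trans (sup_le_sup_left Ideal.mul_le_right _)

omit hp [CharP K p] in
/-- Hence `(v)·I + 𝔪₀ᵏ = I + 𝔪₀ᵏ` for `v(0) ≠ 0`. [folklore] -/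
theorem span_mul_sup_pow_eq {v : MvPolynomial (Fin 4) K} (hv : constantCoeff v ≠ 0)
    (I : Ideal (MvPolynomial (Fin 4) K)) (k : ℕ) : Ideal.span {v} * I ⊔ originIdeal K ^ k = I ⊔ originIdeal K ^ k :=
  le_antisymm (sup_le_sup_right Ideal.mul_le_left _) (sup_le (le_span_mul_sup_pow hv I k) le_sup_right)

/-- **ISOLATION IS INVARIANT UNDER `p`-TH-POWER UNIT FACTORS**: for `u(0) ≠ 0`,
`IsIsolated p (u^p · F) ↔ IsIsolated p F`. [folklore] -/
theorem isIsolated_pow_char_mul_iff {u : MvPolynomial (Fin 4) K} (hu : constantCoeff u ≠ 0)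
    (F : MvPolynomial (Fin 4) K) : IsIsolated p (u ^ p * F) ↔ IsIsolated p F := by
  have hv : constantCoeff (u ^ p) ≠ 0 := by rw [map_pow]; exact pow_ne_zero _ hu
  have hJ : singLocusIdeal p (u ^ p * F) = Ideal.span {u ^ p} * singLocusIdeal p F :=
    singLocusIdeal_pow_char_mul p u F
  constructor
  · intro h
    obtain ⟨N, hN⟩ := IsolationConverse.exists_certificate_of_isIsolated h
    refine IsolationCert.isIsolated_of_pow_le_sup_pow_succ ?_ (N := N) ?_
    · refine (le_span_mul_sup_pow hv _ 1).trans (sup_le ?_ (by rw [pow_one]))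
      rw [← hJ]; exact h.1
    · rw [hJ, span_mul_sup_pow_eq hv] at hN; exact hN
  · intro h
    obtain ⟨N, hN⟩ := IsolationConverse.exists_certificate_of_isIsolated h
    refine IsolationCert.isIsolated_of_pow_le_sup_pow_succ ?_ (N := N) ?_
    · rw [hJ]; exact Ideal.mul_le_left.trans h.1
    · rw [hJ, span_mul_sup_pow_eq hv]; exact hN

omit hp [CharP K p] in
/-- `ord₀ (v · F) = ord₀ F` for `v(0) ≠ 0`. [folklore] -/
theorem ordZero_unit_mul {v : MvPolynomial (Fin 4) K} (hv : constantCoeff v ≠ 0) (F : MvPolynomial (Fin 4) K) :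
    ordZero (v * F) = ordZero F := by
  rw [ordZero_mul]
  have h0 : ordZero v = 0 := by
    by_contra h
    have h1 : 1 ≤ ordZero v := Order.one_le_iff_ne_zero.mpr h
    exact hv ((one_le_ordZero_iff v).mp h1)
  rw [h0, zero_add]

end Units

end ApproxCoordChange

end Summit.ResolutionOfSingularities.ResolutionOfSingularities.Theorems.PIDim4

end
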